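import Literature.AnabelianGeometry.SemiGraphs.TemperedCompactInVerticialAt
import HarnessLib

/-!
# [SemiAnbd] Thm 3.7 (iii) AT ONE GRAPH: old ⇒ new, and the BRIDGE from finite-level data (φ2 / α4-3 (i))

Mochizuki, *Semi-graphs of anabelioids*, Publ. RIMS **42** (2006), §3, Theorem 3.7 (iii), (iv), manuscript
pp. 40–41 [cite: MochizukiSemiAnbd2006, Thm 3.7(iii)(iv) pp.40-41].

PROOF-ONLY companion of `TemperedCompactInVerticialAt.lean` (abc-iut cell wave-4 seat abc-iut-w4-d075,
L3-lead ruling α4-3 (i)): the ∀-countable frozen facts specialise to the per-graph predicates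
(`…At_of_…`), and — the BRIDGE — finite-level data at ONE chart of `𝒢` (the deliverable of the finite-`𝔾`
producer, cell ruling φ2) give `CompactInVerticialAt 𝒢` at EVERY chart, by the chart transport
`FiniteLevelData.nonempty_of_nonempty`, abc-iut-L3-t10's reduction `FiniteLevelData.compactInVerticial` and
Thm 3.7 (i), (ii) (`verticialInjective_holds`, `verticialDistinct_holds`).  Nothing here asserts Thm 3.7 (iii)
for an infinite `𝔾`; nothing bears on [IUTchIII] Cor. 3.12.
-/

namespace Literature.AnabelianGeometry.SemiGraphs

namespace ProfiniteSemiGraph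

open Topology

universe v u

/-- Old ⇒ new: the ∀-countable fact specialises to every graph. [cite: MochizukiSemiAnbd2006, Thm 3.7(iii)
pp.40-41] -/
theorem compactInVerticialAt_of_compactInVerticial (h : CompactInVerticial.{u}) (𝒢 : ProfiniteSemiGraph.{u}) :
    CompactInVerticialAt 𝒢 :=
  h 𝒢

/-- Old ⇒ new for Thm 3.7 (iv). [cite: MochizukiSemiAnbd2006, Thm 3.7(iv) p.41] -/
theorem maximalCompactIffVerticialAt_of_maximalCompactIffVerticial (h : MaximalCompactIffVerticial.{u})
    (𝒢 : ProfiniteSemiGraph.{u}) : MaximalCompactIffVerticialAt 𝒢 :=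
  h 𝒢

/-- Old ⇒ new for the rung-4 residual. [cite: MochizukiSemiAnbd2006, Thm 3.7(iv) p.41] -/
theorem edgeLikeIsInfVerticialAt_of_edgeLikeIsInfVerticial (h : EdgeLikeIsInfVerticial.{u})
    (𝒢 : ProfiniteSemiGraph.{u}) : EdgeLikeIsInfVerticialAt 𝒢 :=
  h 𝒢

/-- Old ⇒ new for `EdgeLikeDistinct`. [cite: MochizukiSemiAnbd2006, Thm 3.7(ii)(iv) pp.40-41] -/
theorem edgeLikeDistinctAt_of_edgeLikeDistinct (h : EdgeLikeDistinct.{u}) (𝒢 : ProfiniteSemiGraph.{u}) :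
    EdgeLikeDistinctAt 𝒢 :=
  h 𝒢

/-! ### The BRIDGE: finite-level data at one chart ⇒ Thm 3.7 (iii) at `𝒢` -/

variable {𝒢 : ProfiniteSemiGraph.{u}}

/-- **BRIDGE (producer ⇒ per-graph (iii)):** if finite-level data exist for some chart `c₀` of `𝒢` (the
deliverable of the finite-`𝔾` producer), then `CompactInVerticialAt 𝒢` — for EVERY chart, by the chart
transport `FiniteLevelData.nonempty_of_nonempty`, abc-iut-L3-t10's reduction `FiniteLevelData.compactInVerticial`
and Thm 3.7 (i), (ii) (`verticialInjective_holds`, `verticialDistinct_holds`).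
[cite: MochizukiSemiAnbd2006, Thm 3.7(iii) pp.40-41] -/
theorem compactInVerticialAt_of_finiteLevelData
    (hD : ∃ c₀ : TemperedPiChart 𝒢, Nonempty (FiniteLevelData.{v} 𝒢 c₀)) : CompactInVerticialAt 𝒢 := by
  intro h𝒢 c C hC
  obtain ⟨c₀, h₀⟩ := hD
  obtain ⟨D⟩ := FiniteLevelData.nonempty_of_nonempty h₀ c
  exact FiniteLevelData.compactInVerticial D verticialDistinct_holds h𝒢
    (fun v => (verticialInjective_holds 𝒢 h𝒢 c v).1) C hC

/-- **Thm 3.7 (iii) AT every FINITE `𝒢`** from the producer statement for finite `𝒢` (the φ2 finite twin,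
packaged as the per-graph predicate; = abc-iut-L3-t10's `FiniteLevelData.compactInVerticial_of_finite`).
[cite: MochizukiSemiAnbd2006, Thm 3.7(iii) pp.40-41] -/
theorem compactInVerticialAt_of_finite
    (hDfin : ∀ (𝒢 : ProfiniteSemiGraph.{u}), 𝒢.Thm37Hypotheses → Finite 𝒢.graph.Vertex →
      Finite 𝒢.graph.Edge → ∃ c₀ : TemperedPiChart 𝒢, Nonempty (FiniteLevelData.{v} 𝒢 c₀))
    (hV : Finite 𝒢.graph.Vertex) (hE : Finite 𝒢.graph.Edge) : CompactInVerticialAt 𝒢 :=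
  fun h𝒢 => compactInVerticialAt_of_finiteLevelData (hDfin 𝒢 h𝒢 hV hE) h𝒢

end ProfiniteSemiGraph

end Literature.AnabelianGeometry.SemiGraphs
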